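import Mathlib
import HarnessLib
import Summits.Ventures.LatticeQCDFlow.Scaling.PlaquetteTopLinkOrders

/-!
# LatticeQCDFlow / Scaling — the one-in-six law: in dimension `d ≥ 3`, for every generation order and
# every injective top-link assignment, at least one plaquette in six carries no one-plaquette
# autoregressive structure

HONEST FRAMING: exact (Metropolis-corrected) sampling algorithms for lattice gauge theory;
figures of merit are autocorrelation/cost numbers at stated couplings and volumes; no
continuum-physics claim.

Venture `LatticeQCDFlow` (cell pub-lqcd), topic `Scaling`, FANOUT row 30 (lean-1, GEN-23) — OUR WORK on
THEORY-2.md §4 row C5 (autoregressive context); the QUANTITATIVE form of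
`Scaling/PlaquetteTopLinkOrders.exists_cubeFace_topLink_not_last`.  Fix a list `l` of links of `(ℤ/L)^d`
and an injective assignment `t` of a link to every plaquette.  Call a plaquette `p` BAD if some link
`e' ≠ t p` of `p` does not come strictly before `t p` in `l` — the one-plaquette heat-bath conditioner of
`p` (reading the three links of `p` other than its top link) cannot be used at `t p`.  Every unit
3-cube has a bad face (its six faces are a closed collection), and a plaquette is a face of at most
`2(d−2)` unit 3-cubes; hence `#cubes ≤ 2(d−2)·#bad`.  Since `#cubes = C(d,3)·#sites` and
`#plaquettes = C(d,2)·#sites`, this reads `#bad ≥ #plaquettes/6` in every dimension `d ≥ 3`.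

## What is proved (all [ours])

* **`card_filter_cube_face_le`** — a plaquette is a face of at most `2(d−2)` unit 3-cubes (`d ≥ 3`);
  `card_triple_lt` — `#{a < b < c in Fin d} = C(d,3)` [folklore].
* **`card_cube_le_mul_card_of_faces`**, **`card_plaquette_le_six_mul_card_of_faces`** — if every unit
  cube has a face with property `Q` then `#cubes ≤ 2(d−2)·#{Q}` and `#plaquettes ≤ 6·#{Q}`.
* `cubeFaces_closed_for` — the six faces of a unit cube are closed for any top-link assignment given on
  them; `card_cube_le_mul_card_bad_of_injective`, **`card_plaquette_le_six_mul_card_bad`** — THE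
  ONE-IN-SIX LAW: for every list of links and every injective top-link assignment (`t p` a link of `p`)
  at least one plaquette in six is bad (`d ≥ 3`, any `L`).
* **`card_plaquette_le_six_mul_card_compl_of_good`** — THE SUB-COMPLEX LAW: a collection `B` on which a
  one-plaquette autoregressive structure exists (all of `B` good along some list) misses at least a
  sixth of the plaquettes: `#plaquettes ≤ 6·#(Bᶜ)` (`d ≥ 3`) — a VOLUME's worth against the `2L − 1`
  of two dimensions (`Scaling/AutoregressiveGaugeHeatBathTorusPerimeter`).

Pure lattice combinatorics.  No `def`, no `sorry`, nothing cited as a fact.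
-/

namespace Summit.Ventures.LatticeQCDFlow.Theory2.Autoregressive

open Literature.MathematicalPhysics.QuantumFieldTheory

/-- **A plaquette is a face of at most `2(d−2)` unit 3-cubes** (`d ≥ 3`).  The faces of the cube at `x`
in directions `a < b < c` are `(x; a,b), (x+e_c; a,b), (x; a,c), (x+e_b; a,c), (x; b,c), (x+e_a; b,c)`; a
cube having `(y; i, j)` as a face has directions `{i, j, k}` for some `k ∉ {i, j}` and base `y` or
`y − e_k`. [ours] -/
theorem card_filter_cube_face_le {d L : ℕ} [NeZero L] (hd : 3 ≤ d) (p : Plaquette d L) :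
    ((Finset.univ : Finset (Site d L × {q : Fin d × Fin d × Fin d // q.1 < q.2.1 ∧ q.2.1 < q.2.2})).filter
      (fun c => p ∈ ({(c.1, ⟨(c.2.1.1, c.2.1.2.1), c.2.2.1⟩),
          (c.1.shift c.2.1.2.2, ⟨(c.2.1.1, c.2.1.2.1), c.2.2.1⟩),
          (c.1, ⟨(c.2.1.1, c.2.1.2.2), c.2.2.1.trans c.2.2.2⟩),
          (c.1.shift c.2.1.2.1, ⟨(c.2.1.1, c.2.1.2.2), c.2.2.1.trans c.2.2.2⟩),
          (c.1, ⟨(c.2.1.2.1, c.2.1.2.2), c.2.2.2⟩),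
          (c.1.shift c.2.1.1, ⟨(c.2.1.2.1, c.2.1.2.2), c.2.2.2⟩)} : Finset (Plaquette d L)))).card
      ≤ 2 * (d - 2) := by
  classical
  obtain ⟨y, ⟨⟨i, j⟩, hij⟩⟩ := p
  have h012 : ((⟨0, by omega⟩ : Fin d), (⟨1, by omega⟩ : Fin d), (⟨2, by omega⟩ : Fin d)).1 <
      ((⟨0, by omega⟩ : Fin d), (⟨1, by omega⟩ : Fin d), (⟨2, by omega⟩ : Fin d)).2.1 ∧
      ((⟨0, by omega⟩ : Fin d), (⟨1, by omega⟩ : Fin d), (⟨2, by omega⟩ : Fin d)).2.1 <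
      ((⟨0, by omega⟩ : Fin d), (⟨1, by omega⟩ : Fin d), (⟨2, by omega⟩ : Fin d)).2.2 := by
    simp [Fin.lt_def]
  -- the increasing arrangement of `{i, j, k}` (junk when `k ∈ {i, j}`)
  set tri : Fin d → {q : Fin d × Fin d × Fin d // q.1 < q.2.1 ∧ q.2.1 < q.2.2} := fun k =>
    if h1 : k < i then ⟨(k, i, j), h1, hij⟩
    else if h2 : i < k ∧ k < j then ⟨(i, k, j), h2.1, h2.2⟩
    else if h3 : j < k then ⟨(i, j, k), hij, h3⟩
    else ⟨_, h012⟩ with htri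
  set U : Finset (Site d L × {q : Fin d × Fin d × Fin d // q.1 < q.2.1 ∧ q.2.1 < q.2.2}) :=
    ((Finset.univ.erase i).erase j).biUnion (fun k => {(y, tri k), (y - Pi.single k 1, tri k)}) with hU
  have hUcard : U.card ≤ 2 * (d - 2) := by
    calc U.card ≤ ∑ k ∈ (Finset.univ.erase i).erase j,
          ({(y, tri k), (y - Pi.single k 1, tri k)} : Finset _).card := Finset.card_biUnion_le
      _ ≤ ∑ k ∈ (Finset.univ.erase i).erase j, 2 := Finset.sum_le_sum fun k _ => Finset.card_le_two
      _ = 2 * (d - 2) := by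
          rw [Finset.sum_const, smul_eq_mul, Finset.card_erase_of_mem, Finset.card_erase_of_mem (Finset.mem_univ _),
            Finset.card_univ, Fintype.card_fin]
          · omega
          · exact Finset.mem_erase.2 ⟨(ne_of_lt hij).symm, Finset.mem_univ _⟩
  refine le_trans (Finset.card_le_card fun c hc => ?_) hUcard
  rw [Finset.mem_filter] at hc
  obtain ⟨x, ⟨⟨a, b, e⟩, hab, hbe⟩⟩ := c
  have hae : a < e := hab.trans hbe
  simp only [Finset.mem_insert, Finset.mem_singleton, Prod.mk.injEq, Subtype.mk.injEq] at hc
  rw [hU, Finset.mem_biUnion]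
  simp only [Finset.mem_erase, Finset.mem_univ, and_true, Finset.mem_insert, Finset.mem_singleton,
    Prod.mk.injEq]
  rcases hc.2 with ⟨hx, h⟩ | ⟨hx, h⟩ | ⟨hx, h⟩ | ⟨hx, h⟩ | ⟨hx, h⟩ | ⟨hx, h⟩ <;>
    obtain ⟨rfl, rfl⟩ := h
  · -- face `(x; a, b)`: third direction `e`, base `y = x`
    refine ⟨e, ⟨(ne_of_lt hbe).symm, (ne_of_lt hae).symm⟩, Or.inl ⟨hx.symm, ?_⟩⟩
    simp [htri, not_lt.2 hae.le, not_lt.2 hbe.le, hbe]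
  · -- face `(x + e_e; a, b)`: third direction `e`, base `y − e_e = x`
    refine ⟨e, ⟨(ne_of_lt hbe).symm, (ne_of_lt hae).symm⟩, Or.inr ⟨?_, ?_⟩⟩
    · rw [hx]; simp [Site.shift]
    · simp [htri, not_lt.2 hae.le, not_lt.2 hbe.le, hbe]
  · -- face `(x; a, e)`: third direction `b`
    refine ⟨b, ⟨ne_of_lt hbe, (ne_of_lt hab).symm⟩, Or.inl ⟨hx.symm, ?_⟩⟩
    simp [htri, not_lt.2 hab.le, hab, hbe]
  · refine ⟨b, ⟨ne_of_lt hbe, (ne_of_lt hab).symm⟩, Or.inr ⟨?_, ?_⟩⟩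
    · rw [hx]; simp [Site.shift]
    · simp [htri, not_lt.2 hab.le, hab, hbe]
  · -- face `(x; b, e)`: third direction `a`
    refine ⟨a, ⟨ne_of_lt hae, ne_of_lt hab⟩, Or.inl ⟨hx.symm, ?_⟩⟩
    simp [htri, hab]
  · refine ⟨a, ⟨ne_of_lt hae, ne_of_lt hab⟩, Or.inr ⟨?_, ?_⟩⟩
    · rw [hx]; simp [Site.shift]
    · simp [htri, hab]

/-- **`#{increasing triples of directions} = C(d,3)`**: sorted triples `a < b < c` of `Fin d` are in
bijection with the `3`-element subsets (via `Finset.orderEmbOfFin`). [folklore] -/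
theorem card_triple_lt (d : ℕ) :
    Fintype.card {q : Fin d × Fin d × Fin d // q.1 < q.2.1 ∧ q.2.1 < q.2.2} = d.choose 3 := by
  classical
  -- subsets → triples
  let φ : {s : Finset (Fin d) // s.card = 3} → {q : Fin d × Fin d × Fin d // q.1 < q.2.1 ∧ q.2.1 < q.2.2} :=
    fun s => ⟨(s.1.orderEmbOfFin s.2 0, s.1.orderEmbOfFin s.2 1, s.1.orderEmbOfFin s.2 2),
      (s.1.orderEmbOfFin s.2).strictMono (by decide), (s.1.orderEmbOfFin s.2).strictMono (by decide)⟩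
  -- triples → subsets
  have hcard3 : ∀ q : {q : Fin d × Fin d × Fin d // q.1 < q.2.1 ∧ q.2.1 < q.2.2},
      ({q.1.1, q.1.2.1, q.1.2.2} : Finset (Fin d)).card = 3 := by
    rintro ⟨⟨a, b, c⟩, hab, hbc⟩
    have nab : a ≠ b := ne_of_lt hab
    have nbc : b ≠ c := ne_of_lt hbc
    have nac : a ≠ c := ne_of_lt (hab.trans hbc)
    rw [Finset.card_insert_of_notMem (by simp [nab, nac]), Finset.card_insert_of_notMem (by simp [nbc]),
      Finset.card_singleton]
  let ψ : {q : Fin d × Fin d × Fin d // q.1 < q.2.1 ∧ q.2.1 < q.2.2} → {s : Finset (Fin d) // s.card = 3} :=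
    fun q => ⟨{q.1.1, q.1.2.1, q.1.2.2}, hcard3 q⟩
  -- `φ ∘ ψ = id`
  have hφψ : ∀ q, φ (ψ q) = q := by
    rintro ⟨⟨a, b, c⟩, hab, hbc⟩
    have hmono : StrictMono (![a, b, c] : Fin 3 → Fin d) := by
      refine Fin.strictMono_iff_lt_succ.2 fun i => ?_
      fin_cases i
      · simpa using hab
      · simpa using hbc
    have hmem : ∀ x : Fin 3, (![a, b, c] : Fin 3 → Fin d) x ∈ ({a, b, c} : Finset (Fin d)) := by
      intro x; fin_cases x <;> simp
    have huniq := Finset.orderEmbOfFin_unique (hcard3 ⟨(a, b, c), hab, hbc⟩) hmem hmono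
    apply Subtype.ext
    simp only [φ, ψ]
    have h0 := congrFun huniq 0
    have h1 := congrFun huniq 1
    have h2 := congrFun huniq 2
    simp only [Matrix.cons_val_zero, Matrix.cons_val_one] at h0 h1
    refine Prod.ext h0.symm (Prod.ext h1.symm ?_)
    rw [← h2]; rfl
  have hψinj : Function.Injective ψ := fun q q' h => by rw [← hφψ q, ← hφψ q', h]
  have hφinj : Function.Injective φ := by
    intro s s' h
    apply Subtype.ext
    have hfun : (s.1.orderEmbOfFin s.2 : Fin 3 → Fin d) = s'.1.orderEmbOfFin s'.2 := by
      funext x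
      have h' := congrArg Subtype.val h
      simp only [φ, Prod.mk.injEq] at h'
      fin_cases x
      · exact h'.1
      · exact h'.2.1
      · exact h'.2.2
    have := congrArg Set.range hfun
    rw [Finset.range_orderEmbOfFin, Finset.range_orderEmbOfFin] at this
    exact Finset.coe_injective this
  have hc : Fintype.card {s : Finset (Fin d) // s.card = 3} = d.choose 3 := by
    rw [Fintype.card_finset_len, Fintype.card_fin]
  rw [← hc]
  exact le_antisymm (Fintype.card_le_of_injective ψ hψinj) (Fintype.card_le_of_injective φ hφinj)

/-- **`#cubes ≤ 2(d−2)·#{faces with property Q}`** (`d ≥ 3`).  If every unit 3-cube has a face with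
property `Q`, then, each plaquette being a face of at most `2(d−2)` cubes, at least `#cubes/(2(d−2))`
plaquettes have property `Q`.  Used below with `Q` = «bad for `(l, t)`» and with `Q` = «outside the
sub-complex `B`». [ours] -/
theorem card_cube_le_mul_card_of_faces {d L : ℕ} [NeZero L] (hd : 3 ≤ d) (Q : Plaquette d L → Prop)
    [DecidablePred Q]
    (hQ : ∀ c : Site d L × {q : Fin d × Fin d × Fin d // q.1 < q.2.1 ∧ q.2.1 < q.2.2},
      ∃ p ∈ ({(c.1, ⟨(c.2.1.1, c.2.1.2.1), c.2.2.1⟩),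
          (c.1.shift c.2.1.2.2, ⟨(c.2.1.1, c.2.1.2.1), c.2.2.1⟩),
          (c.1, ⟨(c.2.1.1, c.2.1.2.2), c.2.2.1.trans c.2.2.2⟩),
          (c.1.shift c.2.1.2.1, ⟨(c.2.1.1, c.2.1.2.2), c.2.2.1.trans c.2.2.2⟩),
          (c.1, ⟨(c.2.1.2.1, c.2.1.2.2), c.2.2.2⟩),
          (c.1.shift c.2.1.1, ⟨(c.2.1.2.1, c.2.1.2.2), c.2.2.2⟩)} : Finset (Plaquette d L)), Q p) :
    Fintype.card (Site d L × {q : Fin d × Fin d × Fin d // q.1 < q.2.1 ∧ q.2.1 < q.2.2}) ≤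
      2 * (d - 2) * ((Finset.univ : Finset (Plaquette d L)).filter Q).card := by
  classical
  choose f hf_face hf_Q using hQ
  have hfib : ∀ p ∈ (Finset.univ : Finset (Site d L × {q : Fin d × Fin d × Fin d //
      q.1 < q.2.1 ∧ q.2.1 < q.2.2})).image f, (Finset.univ.filter (fun c => f c = p)).card ≤ 2 * (d - 2) := by
    intro p _
    refine le_trans (Finset.card_le_card fun c hc => ?_) (card_filter_cube_face_le hd p)
    rw [Finset.mem_filter] at hc ⊢
    exact ⟨hc.1, hc.2 ▸ hf_face c⟩
  have h1 := Finset.card_le_mul_card_image (Finset.univ : Finset (Site d L × {q : Fin d × Fin d × Fin d //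
      q.1 < q.2.1 ∧ q.2.1 < q.2.2})) (2 * (d - 2)) hfib
  rw [Finset.card_univ] at h1
  refine h1.trans (Nat.mul_le_mul_left _ (Finset.card_le_card fun p hp => ?_))
  rw [Finset.mem_image] at hp
  obtain ⟨c, -, rfl⟩ := hp
  simp only [Finset.mem_filter, Finset.mem_univ, true_and]
  exact hf_Q c

/-- **`#plaquettes ≤ 6·#{faces with property Q}`** (`d ≥ 3`): the cube count `#cubes = C(d,3)·#sites`
(`card_triple_lt` below) against `#plaquettes = C(d,2)·#sites`. [ours] -/
theorem card_plaquette_le_six_mul_card_of_faces {d L : ℕ} [NeZero L] (hd : 3 ≤ d)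
    (Q : Plaquette d L → Prop) [DecidablePred Q]
    (hQ : ∀ c : Site d L × {q : Fin d × Fin d × Fin d // q.1 < q.2.1 ∧ q.2.1 < q.2.2},
      ∃ p ∈ ({(c.1, ⟨(c.2.1.1, c.2.1.2.1), c.2.2.1⟩),
          (c.1.shift c.2.1.2.2, ⟨(c.2.1.1, c.2.1.2.1), c.2.2.1⟩),
          (c.1, ⟨(c.2.1.1, c.2.1.2.2), c.2.2.1.trans c.2.2.2⟩),
          (c.1.shift c.2.1.2.1, ⟨(c.2.1.1, c.2.1.2.2), c.2.2.1.trans c.2.2.2⟩),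
          (c.1, ⟨(c.2.1.2.1, c.2.1.2.2), c.2.2.2⟩),
          (c.1.shift c.2.1.1, ⟨(c.2.1.2.1, c.2.1.2.2), c.2.2.2⟩)} : Finset (Plaquette d L)), Q p) :
    Fintype.card (Plaquette d L) ≤ 6 * ((Finset.univ : Finset (Plaquette d L)).filter Q).card := by
  have h1 := card_cube_le_mul_card_of_faces hd Q hQ
  rw [Fintype.card_prod, card_triple_lt] at h1
  have h2 := two_mul_card_plaquette d L
  have h3 : 6 * d.choose 3 = (d - 2) * ((d - 1) * d) := by
    have h := Nat.descFactorial_eq_factorial_mul_choose d 3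
    have h' : d.descFactorial 3 = (d - 2) * ((d - 1) * d) := by
      simp [Nat.descFactorial_succ, Nat.descFactorial_zero]
    have hf : Nat.factorial 3 = 6 := by decide
    rw [← hf, ← h, h']
  generalize hm : d - 2 = m at h1 h3
  generalize hn : d - 1 = n at h2 h3
  have hm0 : 0 < m := by omega
  refine Nat.le_of_mul_le_mul_left ?_ (show 0 < 2 * m by omega)
  have h5 : 2 * m * Fintype.card (Plaquette d L) = 6 * (Fintype.card (Site d L) * d.choose 3) := by
    calc 2 * m * Fintype.card (Plaquette d L) = m * (2 * Fintype.card (Plaquette d L)) := by ring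
      _ = m * (Fintype.card (Site d L) * (d * n)) := by rw [h2]
      _ = Fintype.card (Site d L) * (m * (n * d)) := by ring
      _ = Fintype.card (Site d L) * (6 * d.choose 3) := by rw [h3]
      _ = 6 * (Fintype.card (Site d L) * d.choose 3) := by ring
  rw [h5]
  calc 6 * (Fintype.card (Site d L) * d.choose 3) ≤ 6 * (2 * m * _) := Nat.mul_le_mul_left _ h1
    _ = 2 * m * (6 * _) := by ring

/-- **At least `#cubes/(2(d−2))` bad plaquettes** (`d ≥ 3`), for every list of links and every injective
top-link assignment: every unit cube has a bad face (`exists_cubeFace_topLink_not_last`). [ours] -/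
theorem card_cube_le_mul_card_bad_of_injective {d L : ℕ} [NeZero L] (hd : 3 ≤ d)
    (t : Plaquette d L → Edge d L)
    (ht : ∀ p : Plaquette d L, t p ∈ ({(p.1, p.2.1.1), (p.1.shift p.2.1.1, p.2.1.2),
        (p.1.shift p.2.1.2, p.2.1.1), (p.1, p.2.1.2)} : Finset (Edge d L)))
    (hinj : Function.Injective t) (l : List (Edge d L)) :
    Fintype.card (Site d L × {q : Fin d × Fin d × Fin d // q.1 < q.2.1 ∧ q.2.1 < q.2.2}) ≤
      2 * (d - 2) * ((Finset.univ : Finset (Plaquette d L)).filter (fun p =>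
        ∃ e' ∈ ({(p.1, p.2.1.1), (p.1.shift p.2.1.1, p.2.1.2),
          (p.1.shift p.2.1.2, p.2.1.1), (p.1, p.2.1.2)} : Finset (Edge d L)),
        e' ≠ t p ∧ ¬ l.idxOf e' < l.idxOf (t p))).card := by
  classical
  have h := card_cube_le_mul_card_of_faces hd (fun p : Plaquette d L =>
      ∃ e' ∈ ({(p.1, p.2.1.1), (p.1.shift p.2.1.1, p.2.1.2),
        (p.1.shift p.2.1.2, p.2.1.1), (p.1, p.2.1.2)} : Finset (Edge d L)),
        e' ≠ t p ∧ ¬ l.idxOf e' < l.idxOf (t p)) fun c => by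
    obtain ⟨x, ⟨⟨a, b, e⟩, hab, hbe⟩⟩ := c
    exact exists_cubeFace_topLink_not_last x hab hbe t ht hinj l
  convert h using 4

/-- **The six faces of a unit cube are closed for any top-link assignment** (`a < b < c`): if `t p` is a
link of `p` for each of the six faces, then the top link of every face lies on another face (each of the
twelve links of the cube lies on exactly two faces, in different planes).  The case analysis of
`Scaling/PlaquetteTopLinkOrders.exists_cubeFace_topLink_not_last`, restated for assignments given on the
faces only. [ours] -/
theorem cubeFaces_closed_for {d L : ℕ} [NeZero L] (x : Site d L) {a b c : Fin d} (hab : a < b) (hbc : b < c)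
    (t : Plaquette d L → Edge d L)
    (ht : ∀ p ∈ ({(x, ⟨(a, b), hab⟩), (x.shift c, ⟨(a, b), hab⟩), (x, ⟨(a, c), hab.trans hbc⟩),
        (x.shift b, ⟨(a, c), hab.trans hbc⟩), (x, ⟨(b, c), hbc⟩), (x.shift a, ⟨(b, c), hbc⟩)} :
        Finset (Plaquette d L)), t p ∈ ({(p.1, p.2.1.1), (p.1.shift p.2.1.1, p.2.1.2),
        (p.1.shift p.2.1.2, p.2.1.1), (p.1, p.2.1.2)} : Finset (Edge d L))) :
    ∀ p ∈ ({(x, ⟨(a, b), hab⟩), (x.shift c, ⟨(a, b), hab⟩), (x, ⟨(a, c), hab.trans hbc⟩),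
        (x.shift b, ⟨(a, c), hab.trans hbc⟩), (x, ⟨(b, c), hbc⟩), (x.shift a, ⟨(b, c), hbc⟩)} :
        Finset (Plaquette d L)),
      ∃ p' ∈ ({(x, ⟨(a, b), hab⟩), (x.shift c, ⟨(a, b), hab⟩), (x, ⟨(a, c), hab.trans hbc⟩),
        (x.shift b, ⟨(a, c), hab.trans hbc⟩), (x, ⟨(b, c), hbc⟩), (x.shift a, ⟨(b, c), hbc⟩)} :
        Finset (Plaquette d L)), p' ≠ p ∧ t p ∈ ({(p'.1, p'.2.1.1), (p'.1.shift p'.2.1.1, p'.2.1.2),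
        (p'.1.shift p'.2.1.2, p'.2.1.1), (p'.1, p'.2.1.2)} : Finset (Edge d L)) := by
  classical
  intro p hp
  have hac : a < c := hab.trans hbc
  have nab : a ≠ b := ne_of_lt hab
  have nbc : b ≠ c := ne_of_lt hbc
  have hsc : ∀ (y : Site d L) (i j : Fin d), (y.shift i).shift j = (y.shift j).shift i :=
    fun y i j => by simp only [Site.shift, add_right_comm]
  have he := ht p hp
  revert he
  generalize t p = e
  intro he
  simp only [Finset.mem_insert, Finset.mem_singleton] at hp
  have pab_ac : (⟨(a, b), hab⟩ : {q : Fin d × Fin d // q.1 < q.2}) ≠ ⟨(a, c), hac⟩ := by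
    intro h; exact nbc (congrArg (fun q => q.1.2) h)
  have pab_bc : (⟨(a, b), hab⟩ : {q : Fin d × Fin d // q.1 < q.2}) ≠ ⟨(b, c), hbc⟩ := by
    intro h; exact nab (congrArg (fun q => q.1.1) h)
  have pac_bc : (⟨(a, c), hac⟩ : {q : Fin d × Fin d // q.1 < q.2}) ≠ ⟨(b, c), hbc⟩ := by
    intro h; exact nab (congrArg (fun q => q.1.1) h)
  rcases hp with rfl | rfl | rfl | rfl | rfl | rfl <;>
    simp only [Finset.mem_insert, Finset.mem_singleton] at he <;>
    rcases he with rfl | rfl | rfl | rfl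
  -- F1 = (x; a,b): links (x,a) (x+a,b) (x+b,a) (x,b) → F3, F6, F4, F5
  · exact ⟨(x, ⟨(a, c), hac⟩), by simp, fun h => pab_ac (congrArg Prod.snd h).symm, by simp⟩
  · exact ⟨(x.shift a, ⟨(b, c), hbc⟩), by simp, fun h => pab_bc (congrArg Prod.snd h).symm, by simp⟩
  · exact ⟨(x.shift b, ⟨(a, c), hac⟩), by simp, fun h => pab_ac (congrArg Prod.snd h).symm, by simp⟩
  · exact ⟨(x, ⟨(b, c), hbc⟩), by simp, fun h => pab_bc (congrArg Prod.snd h).symm, by simp⟩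
  -- F2 = (x+c; a,b): links (x+c,a) (x+c+a,b) (x+c+b,a) (x+c,b) → F3, F6, F4, F5
  · exact ⟨(x, ⟨(a, c), hac⟩), by simp, fun h => pab_ac (congrArg Prod.snd h).symm, by simp⟩
  · exact ⟨(x.shift a, ⟨(b, c), hbc⟩), by simp, fun h => pab_bc (congrArg Prod.snd h).symm,
      by simp [hsc x c a]⟩
  · exact ⟨(x.shift b, ⟨(a, c), hac⟩), by simp, fun h => pab_ac (congrArg Prod.snd h).symm,
      by simp [hsc x c b]⟩
  · exact ⟨(x, ⟨(b, c), hbc⟩), by simp, fun h => pab_bc (congrArg Prod.snd h).symm, by simp⟩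
  -- F3 = (x; a,c): links (x,a) (x+a,c) (x+c,a) (x,c) → F1, F6, F2, F5
  · exact ⟨(x, ⟨(a, b), hab⟩), by simp, fun h => pab_ac (congrArg Prod.snd h), by simp⟩
  · exact ⟨(x.shift a, ⟨(b, c), hbc⟩), by simp, fun h => pac_bc (congrArg Prod.snd h).symm, by simp⟩
  · exact ⟨(x.shift c, ⟨(a, b), hab⟩), by simp, fun h => pab_ac (congrArg Prod.snd h), by simp⟩
  · exact ⟨(x, ⟨(b, c), hbc⟩), by simp, fun h => pac_bc (congrArg Prod.snd h).symm, by simp⟩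
  -- F4 = (x+b; a,c): links (x+b,a) (x+b+a,c) (x+b+c,a) (x+b,c) → F1, F6, F2, F5
  · exact ⟨(x, ⟨(a, b), hab⟩), by simp, fun h => pab_ac (congrArg Prod.snd h), by simp⟩
  · exact ⟨(x.shift a, ⟨(b, c), hbc⟩), by simp, fun h => pac_bc (congrArg Prod.snd h).symm,
      by simp [hsc x b a]⟩
  · exact ⟨(x.shift c, ⟨(a, b), hab⟩), by simp, fun h => pab_ac (congrArg Prod.snd h),
      by simp [hsc x b c]⟩
  · exact ⟨(x, ⟨(b, c), hbc⟩), by simp, fun h => pac_bc (congrArg Prod.snd h).symm, by simp⟩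
  -- F5 = (x; b,c): links (x,b) (x+b,c) (x+c,b) (x,c) → F1, F4, F2, F3
  · exact ⟨(x, ⟨(a, b), hab⟩), by simp, fun h => pab_bc (congrArg Prod.snd h), by simp⟩
  · exact ⟨(x.shift b, ⟨(a, c), hac⟩), by simp, fun h => pac_bc (congrArg Prod.snd h), by simp⟩
  · exact ⟨(x.shift c, ⟨(a, b), hab⟩), by simp, fun h => pab_bc (congrArg Prod.snd h), by simp⟩
  · exact ⟨(x, ⟨(a, c), hac⟩), by simp, fun h => pac_bc (congrArg Prod.snd h), by simp⟩
  -- F6 = (x+a; b,c): links (x+a,b) (x+a+b,c) (x+a+c,b) (x+a,c) → F1, F4, F2, F3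
  · exact ⟨(x, ⟨(a, b), hab⟩), by simp, fun h => pab_bc (congrArg Prod.snd h), by simp⟩
  · exact ⟨(x.shift b, ⟨(a, c), hac⟩), by simp, fun h => pac_bc (congrArg Prod.snd h),
      by simp [hsc x a b]⟩
  · exact ⟨(x.shift c, ⟨(a, b), hab⟩), by simp, fun h => pab_bc (congrArg Prod.snd h),
      by simp [hsc x a c]⟩
  · exact ⟨(x, ⟨(a, c), hac⟩), by simp, fun h => pac_bc (congrArg Prod.snd h), by simp⟩

/-! ## The one-in-six law and the sub-complex law -/

/-- **The one-in-six law** (`d ≥ 3`): for every list of links of `(ℤ/L)^d` and every injective top-link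
assignment `t` (`t p` a link of `p`), at least one plaquette in six is bad:
`#plaquettes ≤ 6·#{p : some link e' ≠ t p of p is not before t p}`. [ours] -/
theorem card_plaquette_le_six_mul_card_bad {d L : ℕ} [NeZero L] (hd : 3 ≤ d)
    (t : Plaquette d L → Edge d L)
    (ht : ∀ p : Plaquette d L, t p ∈ ({(p.1, p.2.1.1), (p.1.shift p.2.1.1, p.2.1.2),
        (p.1.shift p.2.1.2, p.2.1.1), (p.1, p.2.1.2)} : Finset (Edge d L)))
    (hinj : Function.Injective t) (l : List (Edge d L)) :
    Fintype.card (Plaquette d L) ≤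
      6 * ((Finset.univ : Finset (Plaquette d L)).filter (fun p =>
        ∃ e' ∈ ({(p.1, p.2.1.1), (p.1.shift p.2.1.1, p.2.1.2),
          (p.1.shift p.2.1.2, p.2.1.1), (p.1, p.2.1.2)} : Finset (Edge d L)),
        e' ≠ t p ∧ ¬ l.idxOf e' < l.idxOf (t p))).card := by
  classical
  have h := card_plaquette_le_six_mul_card_of_faces hd (fun p : Plaquette d L =>
      ∃ e' ∈ ({(p.1, p.2.1.1), (p.1.shift p.2.1.1, p.2.1.2),
        (p.1.shift p.2.1.2, p.2.1.1), (p.1, p.2.1.2)} : Finset (Edge d L)),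
        e' ≠ t p ∧ ¬ l.idxOf e' < l.idxOf (t p)) fun c => by
    obtain ⟨x, ⟨⟨a, b, e⟩, hab, hbe⟩⟩ := c
    exact exists_cubeFace_topLink_not_last x hab hbe t ht hinj l
  convert h using 4

/-- **An HB-structured sub-complex misses at least a sixth of the plaquettes in `d ≥ 3`.**  Let `B` be a
collection of plaquettes of `(ℤ/L)^d`, `t` a top-link assignment (`t p` a link of `p`) injective on `B`,
and `l` a list of links along which EVERY plaquette of `B` is good (each link `e' ≠ t p` of `p ∈ B`
strictly before `t p`) — the situation of an exact one-plaquette heat-bath autoregression on `B`.  Then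
every unit cube has a face outside `B` (its six faces are closed for `t`), so `#plaquettes ≤ 6·#(Bᶜ)`:
the importance ratio of such a sampler against the full Wilson-type weight carries at least a sixth of
all plaquettes — a VOLUME's worth, in contrast with the `2L − 1` plaquettes (perimeter) left over in two
dimensions (`Scaling/AutoregressiveGaugeHeatBathTorusPerimeter`). [ours] -/
theorem card_plaquette_le_six_mul_card_compl_of_good {d L : ℕ} [NeZero L] (hd : 3 ≤ d)
    (B : Finset (Plaquette d L)) (t : Plaquette d L → Edge d L)
    (ht : ∀ p ∈ B, t p ∈ ({(p.1, p.2.1.1), (p.1.shift p.2.1.1, p.2.1.2),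
        (p.1.shift p.2.1.2, p.2.1.1), (p.1, p.2.1.2)} : Finset (Edge d L)))
    (hinj : Set.InjOn t B) (l : List (Edge d L))
    (hgood : ∀ p ∈ B, ∀ e' ∈ ({(p.1, p.2.1.1), (p.1.shift p.2.1.1, p.2.1.2),
        (p.1.shift p.2.1.2, p.2.1.1), (p.1, p.2.1.2)} : Finset (Edge d L)), e' ≠ t p →
      l.idxOf e' < l.idxOf (t p)) :
    Fintype.card (Plaquette d L) ≤ 6 * (Finset.univ \ B).card := by
  classical
  have hfilter : (Finset.univ : Finset (Plaquette d L)).filter (fun p => p ∉ B) = Finset.univ \ B := by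
    ext p; simp
  have h := card_plaquette_le_six_mul_card_of_faces hd (fun p => p ∉ B) fun c => ?_
  · rw [hfilter] at h; exact h
  obtain ⟨x, ⟨⟨a, b, e⟩, hab, hbe⟩⟩ := c
  by_contra hall
  push Not at hall
  have hsub : ∀ p ∈ ({(x, ⟨(a, b), hab⟩), (x.shift e, ⟨(a, b), hab⟩), (x, ⟨(a, e), hab.trans hbe⟩),
      (x.shift b, ⟨(a, e), hab.trans hbe⟩), (x, ⟨(b, e), hbe⟩), (x.shift a, ⟨(b, e), hbe⟩)} :
      Finset (Plaquette d L)), p ∈ B := hall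
  have hclosed := cubeFaces_closed_for x hab hbe t (fun p hp => ht p (hsub p hp))
  have hinjS : Set.InjOn t (({(x, ⟨(a, b), hab⟩), (x.shift e, ⟨(a, b), hab⟩), (x, ⟨(a, e), hab.trans hbe⟩),
      (x.shift b, ⟨(a, e), hab.trans hbe⟩), (x, ⟨(b, e), hbe⟩), (x.shift a, ⟨(b, e), hbe⟩)} :
      Finset (Plaquette d L)) : Set (Plaquette d L)) :=
    fun p hp p' hp' h => hinj (hsub p (Finset.mem_coe.1 hp)) (hsub p' (Finset.mem_coe.1 hp')) h
  have hne : (({(x, ⟨(a, b), hab⟩), (x.shift e, ⟨(a, b), hab⟩), (x, ⟨(a, e), hab.trans hbe⟩),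
      (x.shift b, ⟨(a, e), hab.trans hbe⟩), (x, ⟨(b, e), hbe⟩), (x.shift a, ⟨(b, e), hbe⟩)} :
      Finset (Plaquette d L))).Nonempty := ⟨(x, ⟨(a, b), hab⟩), Finset.mem_insert_self _ _⟩
  obtain ⟨p, hp, e', he', hne', hlt⟩ := exists_topLink_not_last_of_closed _ hne t hclosed hinjS l
  exact hlt (hgood p (hsub p hp) e' he' hne')

end Summit.Ventures.LatticeQCDFlow.Theory2.Autoregressive
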